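import Summits.CriticalPhenomena.SAWScalingLimit.Theorems.SAWDevelopingMapObservableToSLETypeLadderResidue
import Summits.CriticalPhenomena.SAWScalingLimit.Theorems.SAWDevelopingMapObservableToSLETypeLadderNoMacroBacktracking
import Summits.CriticalPhenomena.SAWScalingLimit.Theorems.SAWDevelopingMapObservableToSLETypeLadderBandDefs
import Summits.CriticalPhenomena.SAWScalingLimit.Theorems.SAWDevelopingMapObservableToSLETypeLadderBandIteration
import Summits.CriticalPhenomena.SAWScalingLimit.Theses.SAWSpinMonotone
import HarnessLib.Audit

/-!
# Line `six-class-type-ladder` (payload slug `Sketch`) — crux `SAWDevelopingMap.ObservableToSLE`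
(stmt-CriticalPhenomena-10472; `Iff.rfl`-identical to the twin crux stmt-CriticalPhenomena-14005
`SAWDefectDecoherence.ObservableToSLER` and to the bet route's copy `SAWSpinMonotone.ObservableToSLE`)

## r17 (lead c6, 2026-08-17 ~16:45Z): THE BAND ITERATION IS LANDED — `TypeLadder.stub_bandIteration` (p170219) over `stub_oneEndBound` (p170119),
## `stub_bandAssembly` (p169956), `stub_bandIterate` (p169808), reversal (p169608), prefix conditioning (p169149), splice (p169043), decidedness
## (p168826), good gate (p168809), on the vocabulary BandDefs (p168396; sanity p169629).  I8 is wired by name; S1ᶜ is sorry-free glue over the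
## ONE research leaf R1 `stub_bandRenewal`.  OPEN (3 sorries) = the research surface {R1 BandRenewal, T1⁻ = 17955, T5ₐ = 7148}.
## Theorems-level certificate: `TypeLadder.observableToSLE_of_bandResidue` (file …TypeLadderBandResidue.lean, landing with this revision).

## RESHAPE r16 (lead c6, 2026-08-17 ~16:00Z): THE BAND-WISE CUT OF THE ABUNDANCE.  S1ᶜ `stub_nestedRenewalConditional` is now GLUE
## (`nestedRenewalConditional_of_band`) over TWO registered stubs on the Theorems-side vocabulary `…TypeLadderBandDefs.lean` (p168396:
## `BandFamily`, `BandSuccess`, `BandBoundAt`, `BandRenewal`, `ZEscape`, `NoMacroBacktrackingAt`):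
##   R1  `stub_bandRenewal`   : HexObservableLimit → HexTight → HexSimpleSubseqLimits → ∀ D a b, IsEmbEndpointApprox → BandRenewal D a b
##        — RESEARCH (lead): per band, one end, uniform over self-avoiding pasts confined to the inner ball; the D5.2 cut of the twin's
##        STRATEGY-CENSUS-s5a made precise (flat-strip floor = bridge band mass / doubling of B_T(x_c), idea `bandwise-renewal-density`);
##   I8  `stub_bandIteration` : (∀ D a b, … → BandRenewal D a b) → (∀ D a b, … → NoMacroBacktrackingAt D a b) → ⟨item 17698 body⟩
##        — PROVABLE (L): protection radii chosen top-down by NB, prefix conditioning (exact domain Markov through `carvedLaw`,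
##        registered piece `stub_prefixConditioning`), decidedness of band success by the exit prefix (`stub_bandSuccess_decided`), good
##        gate = band success ∧ no NB-return ∧ z₀-escape (`stub_goodRenewal_of_bandSuccess`), splicing of the band families
##        (`stub_spliceBandFamilies`), m-fold iteration P(all bands fail) ≤ c₀^m, two ends by reversal, WideLink = two z₀-escapes
##        (`wideLink_of_zEscape`, landed in BandDefs).  Wave 2 = the four registered pieces; wave 3 = iteration + assembly.
## OPEN (4 sorries): R1 (research), I8 (provable), T1⁻ = 17955, T5ₐ = 7148.

## r15 (lead c6, 2026-08-17 ~15:25Z): NB LANDED — `TypeLadder.stub_noMacroBacktracking` (p168181, wave 1, 399 lines: closed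
## representative-independent `visitsThen` events, Prokhorov + portmanteau scheme `exists_eventually_measure_le_of_antitone`) is wired by name;
## wave 1 also landed the twin's hull-first provable stubs M `HullFirst.stub_monotoneOfNoRetrace` (p167748) and C
## `HullFirst.stub_curveLawOfRangeLaw` (p167960).  OPEN (3 sorries) = the research surface {S1ᶜ, T1⁻ = 17955, T5ₐ = 7148}.

## r14 (continuation lead c6, 2026-08-17 ~15:00Z): CONDITIONAL ABUNDANCE + the no-backtracking lemma

State inherited (r13, lead c5, 13:20Z): the provable half of the line is CLOSED and in the tree —
`TypeLadder.observableToSLE_of_residue` (p163920) gives the crux from EXACTLY three research leaves, all ledger items: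
S1 `stub_nestedRenewalFatCoSolidR` (= stmt-17698, abundance of widely linked first good gates for fat co-oriented solid
tame nested families — the only input not implied in substance by DCS Conjecture 1), T1⁻ `stub_macroSourceLocality`
(= stmt-17955) and T5ₐ `stub_hexSimpleSubseqLimits` (= stmt-7148).  r1–r13 history: see the r13 tree copy attached as
evidence (2026-08-17T13:20Z `ObservableToSLE.lean`) and `Cruxes/ObservableToSLE/LINE-STATUS.md`; ~85 landed files
`Theorems/SAWDevelopingMapObservableToSLETypeLadder*.lean`.

THIS RESHAPE (adopting the twin strategists' recommendation s5/s5a, `Cruxes/ObservableToSLER/S1-FLOOR-s5a.md` §2 and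
`Cruxes/ObservableToSLER/Lines/conditional-abundance.md`, to THIS crux):

* S1 is re-asked CONDITIONALLY — `stub_nestedRenewalConditional : HexObservableLimit → HexTight → HexSimpleSubseqLimits →
  NoMacroBacktracking → ⟨S1 body verbatim⟩`.  All four hypotheses are free in the composition (`hO`, `hT` are the crux's
  own; simplicity is the co-residue T5ₐ; no-backtracking is the new provable stub).  Why this is a genuine weakening and not a
  costume: a good gate asks that the walk NEVER return to the level (`IsGoodGateN`), an event decided by the whole future, so
  an unconditional proof of S1 must bound MACROSCOPIC BACKTRACKING to the root — a boundary two-arm species with no lattice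
  tool at `n = 0`; granted tightness and simplicity of subsequential limits that species is SOFT (next stub), and what is
  left of abundance is LOCAL to the scales `[ρ, 2R]` at each mark (band-wise clean single crossing given an un-caged past +
  cage rarity; census `Cruxes/ObservableToSLER/STRATEGY-CENSUS-s5a.md` §T5.2/§D5.2).
* NEW PROVABLE stub `stub_noMacroBacktracking : HexTight → HexSimpleSubseqLimits → NoMacroBacktracking` (all inlined):
  Prokhorov along a violating mesh sequence (`IsTightAlongMesh.exists_subseq`), portmanteau on the CLOSED `CurveClass`
  events "at distance `≥ R′` from `pt 0` at some time and within `r` of it at a later time" (resp. the time-reversed events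
  at `pt 1`), which decrease as `r → 0` to "the curve revisits its source after leaving `B(pt 0, R′)`" — null for every
  simple class from `pt 0` to `pt 1`; the pattern of `Modulus.stub_hexUniformModulus_of_simpleLimits` (p127640).
* T1⁻ and T5ₐ unchanged (items 17955, 7148 verbatim).
* Composition: `observableToSLE_of_residue` (landed) ∘ the conditional stub; the bet route's copy
  `SAWSpinMonotone.ObservableToSLE` is concluded by the same term (`ObservableToSLE_of_spinMonotone`).

REGISTERED STUBS (r14/r15; 3 with `sorry` from r15; r16: 4 = R1, I8, T1⁻, T5ₐ): S1ᶜ `stub_nestedRenewalConditional` (research, lead), NB `stub_noMacroBacktracking`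
(provable M–L, wave 1 — LANDED p168181), T1⁻ `stub_macroSourceLocality` (research = item 17955), T5ₐ `stub_hexSimpleSubseqLimits`
(research = item 7148).  `ObservableToSLE_of` is sorry-free over them and concludes the crux BY NAME.

Disproof.lean (crux dir, cdisprove v13) honoured: §1 no `_false_without_` theorem exists; both hypotheses are consumed (`R`
inside the landed two-piece identification on class-`(0,0)` data AND now as a hypothesis of S1ᶜ; `HexTight` through
`MidTightN`, Prokhorov, and NB); W1/W2/RootSilence — unchanged from r13 (renewal + exact restriction at clean flat gates,
never an observable at a rough or slit root); `Negative.ModulusNecessity`/`TightnessNecessity`: the hypotheses added to S1 are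
themselves Conj.1-necessary, so S1ᶜ is not weaker than needed; §10 Targets `stuck_stubs = []`.
-/

noncomputable section

open scoped BigOperators Topology NNReal ENNReal Classical BoundedContinuousFunction ComplexConjugate
open Filter Set MeasureTheory Metric
open Literature.Probability.LatticeModels (HexVertex hexGraph hexCenter triZeta triEmbed Site polyline)
open Literature.Probability.RandomPlanarGeometry
open Literature.Probability.RandomPlanarGeometry.SAW
open UpperHalfPlane (upperHalfPlaneSet)

namespace Summit.CriticalPhenomena.SAWScalingLimit.Cruxes.ObservableToSLE.TypeLadder

open Summit.CriticalPhenomena.SAWScalingLimit.Theses.SAWDevelopingMap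
  (HexObservableLimit HexTight ObservableToSLE)
open Summit.CriticalPhenomena.SAWScalingLimit.Theses.SAWLatticeVirasoro (HexSimpleSubseqLimits)
open Summit.CriticalPhenomena.SAWScalingLimit.Theorems.ObservableToSLER.BridgeGate
open Summit.CriticalPhenomena.SAWScalingLimit.Theorems.ObservableToSLER.NestedGate

/-! ## Typed statements (r13 verbatim unless marked NEW; kept for the record and for the consistency lemmas) -/

/-- **CLASS-`k` WINDOWS** (r1). -/
def ClassWindows (k : Fin 6) (Ω : Set ℂ) (δ ρ : ℝ) (S : ℕ → Set HexVertex) : Prop :=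
  ∀ (n : ℕ) (p q : HexVertex), HasCleanWindow Ω δ ρ (S n) p q →
    rowOf k q = rowOf k p + 1 ∧
      ∀ x : HexVertex, (δ : ℂ) * hexCenter x ∈ ball ((δ : ℂ) * hexCenter q) ρ →
        (x ∈ S n ↔ rowOf k x ≤ rowOf k p)

/-- **FAT LEVEL BODY UNDER EVERY CLEAN WINDOW, class-`k` form** (r1). -/
def FatUnderWindowK (k : Fin 6) (Ω : Set ℂ) (δ ρ : ℝ) (S : ℕ → Set HexVertex) (c : HexVertex) :
    Prop :=
  ∀ (n : ℕ) (p q : HexVertex), HasCleanWindow Ω δ ρ (S n) p q →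
    ∃ K : Set ℂ, IsCompact K ∧ IsConnected K ∧
      (δ : ℂ) * hexCenter q - ((ρ / 2 : ℝ) : ℂ) * Complex.I * triZeta ^ (k : ℕ) ∈ K ∧
      (δ : ℂ) * hexCenter c ∈ K ∧
      ∀ v : HexVertex, Metric.infDist ((δ : ℂ) * hexCenter v) K ≤ ρ / 4 → v ∈ S n

/-- **FAT SPINE** (r6). -/
def FatSpine (δ ρ : ℝ) (S : ℕ → Set HexVertex) (c : HexVertex) : Prop :=
  ∀ i : ℕ, ∃ K : Set ℂ, IsCompact K ∧ IsConnected K ∧ (δ : ℂ) * hexCenter c ∈ K ∧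
    (∀ v : HexVertex, Metric.infDist ((δ : ℂ) * hexCenter v) K ≤ ρ / 8 → v ∈ S i) ∧
    (∀ v ∈ S i, ∃ (t w : HexVertex) (r : ℕ), v ∈ hexBall t r ∧ w ∈ hexBall t r ∧
      hexBall t r ⊆ S i ∧ Metric.infDist ((δ : ℂ) * hexCenter w) K ≤ ρ / 16)

/-- **THE FAMILY CONSTRAINT `FatAnchoredCoOrientedSolid`** (r6). -/
def FatAnchoredCoOrientedSolid : DobrushinDomain → (ℝ → HexVertex) → (ℝ → HexVertex) → ℝ → ℝ → ℝ → ℕ →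
    (ℕ → Set HexVertex) → (ℕ → Set HexVertex) → Prop :=
  fun D a b δ ρ _ _ S T =>
    (∀ n, ExteriorAnchored D.carrier δ (S n) (a δ)) ∧
      (∀ n, ExteriorAnchored D.carrier δ (T n) (b δ)) ∧
      ∃ j : Fin 6,
        (ClassWindows j D.carrier δ ρ S ∧ ClassWindows j D.carrier δ ρ T) ∧
          FatUnderWindowK j D.carrier δ ρ S (a δ) ∧ FatUnderWindowK j D.carrier δ ρ T (b δ) ∧
          FatSpine δ ρ S (a δ) ∧ FatSpine δ ρ T (b δ)

/-- **NESTED RENEWAL UNDER A FAMILY CONSTRAINT `P`, LOCALITY SCALE BOUNDED** (r3). -/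
def NestedRenewalPR (P : DobrushinDomain → (ℝ → HexVertex) → (ℝ → HexVertex) → ℝ → ℝ → ℝ → ℕ →
      (ℕ → Set HexVertex) → (ℕ → Set HexVertex) → Prop) : Prop :=
  ∀ (D : DobrushinDomain) (a b : ℝ → HexVertex), IsEmbEndpointApprox hexGraph hexCenter D a b →
    ∀ ε > (0 : ℝ), ∃ R₂ > (0 : ℝ), ∀ R ∈ Set.Ioc (0 : ℝ) R₂, ∃ ρ > (0 : ℝ), ∃ N : ℕ, ∀ᶠ δ : ℝ in 𝓝[>] 0,
      ∃ S T : ℕ → Set HexVertex,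
        TameNestedFamily δ R N (a δ) S ∧ TameNestedFamily δ R N (b δ) T ∧
        P D a b δ ρ R N S T ∧
        hexSAWLaw D.carrier δ (a δ) (b δ)
            {γ | ¬ ∃ (n m : ℕ) (p q : HexVertex) (n' m' : ℕ) (p' q' : HexVertex),
                IsFirstGoodGateN D.carrier δ ρ R S (a δ) γ.walk.support n m p q ∧
                IsFirstGoodGateN D.carrier δ ρ R T (b δ) γ.walk.support.reverse n' m' p' q' ∧
                WideLink D.carrier δ ρ (S n ∪ T n') q q'} ≤
          ENNReal.ofReal ε

/-- **S1 `NestedRenewalFatCoSolidR`** (r6; = item stmt-CriticalPhenomena-17698). -/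
def NestedRenewalFatCoSolidR : Prop := NestedRenewalPR FatAnchoredCoOrientedSolid

/-- **T1⁻ `MacroSourceLocality`** (r11; = item stmt-CriticalPhenomena-17955). -/
def MacroSourceLocality : Prop :=
  ∀ (E : DobrushinDomain) (ρ : ℝ) (Λ : ℝ → Finset HexVertex) (m₀ : ℝ → ℤ)
    (a : ℝ → Sym2 HexVertex),
    0 < ρ → E.carrier ∩ ball (E.pt 0) ρ = {z : ℂ | (E.pt 0).im < z.im} ∩ ball (E.pt 0) ρ →
    (∀ᶠ δ : ℝ in 𝓝[>] 0, hexDomainSimplyConnected (Λ δ) ∧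
      (hexGraph.induce (↑(Λ δ) : Set HexVertex)).Preconnected ∧ a δ ∈ hexDomainBoundary (Λ δ) ∧
      (∀ v ∈ Λ δ, (δ : ℂ) * hexCenter v ∈ E.carrier) ∧
      (∀ v : HexVertex, (δ : ℂ) * hexCenter v ∈ ball (E.pt 0) ρ → (v ∈ Λ δ ↔ m₀ δ ≤ v.1 1))) →
    (∀ K : Set ℂ, IsCompact K → K ⊆ E.carrier →
      ∀ᶠ δ : ℝ in 𝓝[>] 0, ∀ v : HexVertex, (δ : ℂ) * hexCenter v ∈ K → v ∈ Λ δ) →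
    Tendsto (fun δ : ℝ => (δ : ℂ) * hexMidpoint (a δ)) (𝓝[>] 0) (𝓝 (E.pt 0)) →
    ∀ ε : ℝ, 0 < ε → ∀ r : ℝ, 0 < r → ∃ t₀ : ℝ, 0 < t₀ ∧
      ∀ (s : ℝ → Sym2 HexVertex) (t : ℝ), t ≠ 0 → |t| < t₀ →
        (∀ᶠ δ : ℝ in 𝓝[>] 0, s δ ∈ hexDomainBoundary (Λ δ) ∧
          (hexMidpoint (s δ)).im = (hexMidpoint (a δ)).im) →
        Tendsto (fun δ : ℝ => (δ : ℂ) * hexMidpoint (s δ)) (𝓝[>] 0) (𝓝 (E.pt 0 + t)) →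
        ∀ᶠ δ : ℝ in 𝓝[>] 0,
          (∑ γ : HexMidEdgeSAW (Λ δ) (a δ) (s δ),
              if ∃ v ∈ γ.verts, r ≤ dist ((δ : ℂ) * hexCenter v) ((δ : ℂ) * hexMidpoint (a δ))
              then hexCriticalFugacity ^ γ.length else 0) ≤
            ε * ∑ γ : HexMidEdgeSAW (Λ δ) (a δ) (s δ), hexCriticalFugacity ^ γ.length

/-- **NO MACROSCOPIC BACKTRACKING (`NoMacroBacktracking`, NEW in r14; the twin strategist s5's typed target, verbatim)**:
for every `R′ > 0` and `ε > 0` there is `r > 0` such that eventually in `δ` the critical walk from `a δ` to `b δ` visits a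
vertex within `r` of `pt 0` AFTER a vertex at distance `≥ R′` from it — or, time-reversed at the target, a vertex at distance
`≥ R′` from `pt 1` AFTER a vertex within `r` of it — with `hexSAWLaw`-probability `≤ ε` each. -/
def NoMacroBacktracking : Prop :=
  ∀ (D : DobrushinDomain) (a b : ℝ → HexVertex), IsEmbEndpointApprox hexGraph hexCenter D a b →
    ∀ R' > (0 : ℝ), ∀ ε > (0 : ℝ), ∃ r > (0 : ℝ), ∀ᶠ δ : ℝ in 𝓝[>] 0,
      hexSAWLaw D.carrier δ (a δ) (b δ)
          {γ | ∃ (l₁ l₂ : List HexVertex) (u v : HexVertex), γ.walk.support = l₁ ++ u :: l₂ ∧ v ∈ l₂ ∧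
            R' ≤ dist ((δ : ℂ) * hexCenter u) (D.pt 0) ∧ dist ((δ : ℂ) * hexCenter v) (D.pt 0) ≤ r} ≤
        ENNReal.ofReal ε ∧
      hexSAWLaw D.carrier δ (a δ) (b δ)
          {γ | ∃ (l₁ l₂ : List HexVertex) (u v : HexVertex), γ.walk.support = l₁ ++ u :: l₂ ∧ v ∈ l₂ ∧
            dist ((δ : ℂ) * hexCenter u) (D.pt 1) ≤ r ∧ R' ≤ dist ((δ : ℂ) * hexCenter v) (D.pt 1)} ≤
        ENNReal.ofReal ε

/-- **CONDITIONAL ABUNDANCE (`ConditionalAbundance`, NEW in r14)**: S1 under the crux's hypotheses, the simplicity co-residue and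
no macroscopic backtracking. -/
def ConditionalAbundance : Prop :=
  HexObservableLimit → HexTight → HexSimpleSubseqLimits → NoMacroBacktracking → NestedRenewalFatCoSolidR

/-! ## The four stubs (r14) -/

/-- STUB R1 `stub_bandRenewal` (NEW in r16, RESEARCH, lead-held) — **band-wise renewal at both ends** under the crux's hypotheses and the
simplicity co-residue: for every Dobrushin domain and endpoint approximation, ONE common window class `j` and base point `z₀` such that at each
end the per-band bound `BandBoundAt` holds (`…TypeLadderBandDefs.lean`): ∃ c₀ < 1, θ > 1, R₂, ∀ R ≤ R₂ ∀ P ≤ R ∀ ρin ≤ P/(2θ) ∃ ρw ∀ ρ ≤ ρw ∃ N ∀ᶠ δ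
∃ band family on `[ρin, θρin]`, UNIFORMLY over self-avoiding pasts confined to the closed inner ball, the carved law of the future gives "no clean
first exit from a level without return before distance `P`" mass `≤ c₀`.  Continuum shadow: the void probability of the 3/4-stable regenerative
set of Alberts–Duminil-Copin bridge radii over `[ρin, θρin]`, a constant `< 1` by scaling; flat-strip floor: bridge band mass of `B_T(x_c)` (open). -/
theorem stub_bandRenewal :
    HexObservableLimit → HexTight →
    Summit.CriticalPhenomena.SAWScalingLimit.Theses.SAWLatticeVirasoro.HexSimpleSubseqLimits →
    ∀ (D : DobrushinDomain) (a b : ℝ → HexVertex), IsEmbEndpointApprox hexGraph hexCenter D a b →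
      Summit.CriticalPhenomena.SAWScalingLimit.Theorems.ObservableToSLE.TypeLadder.BandRenewal D a b := by
  sorry

/-- STUB I8 `stub_bandIteration` (NEW in r16; LANDED in r17, p170219 `TypeLadder.stub_bandIteration`, wired by name) — **the band iteration**: band-wise renewal at both ends and no macroscopic
backtracking imply the abundance of widely linked first good gates for fat co-oriented solid tame nested families (the body of item 17698,
verbatim).  Scales top-down by NB (`P_m = R`, `ρin_k = min (r_NB (P_k/2) (ε/8m)) P_k / (2θ)`, `P_{k-1} = ρin_k / 2`), common window radius
`ρ = min ρw`, common complexity `N = max`, band-`k` failure decided by the exit prefix from `B(P_k)` (= band `k+1`'s confined past), prefix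
conditioning ⇒ `P(all m bands fail) ≤ c₀^m ≤ ε/8`, returns from beyond `P_k` charged to NB (`m · ε/8m`), good gate from band success, the
other end by reversal of the walk, the two first good gates linked by their `z₀`-escapes. -/
theorem stub_bandIteration :
    (∀ (D : DobrushinDomain) (a b : ℝ → HexVertex), IsEmbEndpointApprox hexGraph hexCenter D a b →
      Summit.CriticalPhenomena.SAWScalingLimit.Theorems.ObservableToSLE.TypeLadder.BandRenewal D a b) →
    (∀ (D : DobrushinDomain) (a b : ℝ → HexVertex), IsEmbEndpointApprox hexGraph hexCenter D a b →
      Summit.CriticalPhenomena.SAWScalingLimit.Theorems.ObservableToSLE.TypeLadder.NoMacroBacktrackingAt D a b) →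
    ∀ (D : DobrushinDomain) (a b : ℝ → HexVertex), IsEmbEndpointApprox hexGraph hexCenter D a b →
      ∀ ε > (0 : ℝ), ∃ R₂ > (0 : ℝ), ∀ R ∈ Set.Ioc (0 : ℝ) R₂, ∃ ρ > (0 : ℝ), ∃ N : ℕ, ∀ᶠ δ : ℝ in 𝓝[>] 0,
        ∃ S T : ℕ → Set HexVertex,
          TameNestedFamily δ R N (a δ) S ∧ TameNestedFamily δ R N (b δ) T ∧
          ((∀ n, ExteriorAnchored D.carrier δ (S n) (a δ)) ∧
            (∀ n, ExteriorAnchored D.carrier δ (T n) (b δ)) ∧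
            ∃ j : Fin 6,
              ((∀ (n : ℕ) (p q : HexVertex), HasCleanWindow D.carrier δ ρ (S n) p q →
                  rowOf j q = rowOf j p + 1 ∧
                    ∀ x : HexVertex, (δ : ℂ) * hexCenter x ∈ ball ((δ : ℂ) * hexCenter q) ρ →
                      (x ∈ S n ↔ rowOf j x ≤ rowOf j p)) ∧
                (∀ (n : ℕ) (p q : HexVertex), HasCleanWindow D.carrier δ ρ (T n) p q →
                  rowOf j q = rowOf j p + 1 ∧
                    ∀ x : HexVertex, (δ : ℂ) * hexCenter x ∈ ball ((δ : ℂ) * hexCenter q) ρ →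
                      (x ∈ T n ↔ rowOf j x ≤ rowOf j p))) ∧
              (∀ (n : ℕ) (p q : HexVertex), HasCleanWindow D.carrier δ ρ (S n) p q →
                ∃ K : Set ℂ, IsCompact K ∧ IsConnected K ∧
                  (δ : ℂ) * hexCenter q - ((ρ / 2 : ℝ) : ℂ) * Complex.I * triZeta ^ (j : ℕ) ∈ K ∧
                  (δ : ℂ) * hexCenter (a δ) ∈ K ∧
                  ∀ v : HexVertex, Metric.infDist ((δ : ℂ) * hexCenter v) K ≤ ρ / 4 → v ∈ S n) ∧
              (∀ (n : ℕ) (p q : HexVertex), HasCleanWindow D.carrier δ ρ (T n) p q →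
                ∃ K : Set ℂ, IsCompact K ∧ IsConnected K ∧
                  (δ : ℂ) * hexCenter q - ((ρ / 2 : ℝ) : ℂ) * Complex.I * triZeta ^ (j : ℕ) ∈ K ∧
                  (δ : ℂ) * hexCenter (b δ) ∈ K ∧
                  ∀ v : HexVertex, Metric.infDist ((δ : ℂ) * hexCenter v) K ≤ ρ / 4 → v ∈ T n) ∧
              (∀ n : ℕ, ∃ K : Set ℂ, IsCompact K ∧ IsConnected K ∧ (δ : ℂ) * hexCenter (a δ) ∈ K ∧
                (∀ v : HexVertex, Metric.infDist ((δ : ℂ) * hexCenter v) K ≤ ρ / 8 → v ∈ S n) ∧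
                (∀ v ∈ S n, ∃ (t w : HexVertex) (r : ℕ), v ∈ hexBall t r ∧ w ∈ hexBall t r ∧
                  hexBall t r ⊆ S n ∧ Metric.infDist ((δ : ℂ) * hexCenter w) K ≤ ρ / 16)) ∧
              (∀ n : ℕ, ∃ K : Set ℂ, IsCompact K ∧ IsConnected K ∧ (δ : ℂ) * hexCenter (b δ) ∈ K ∧
                (∀ v : HexVertex, Metric.infDist ((δ : ℂ) * hexCenter v) K ≤ ρ / 8 → v ∈ T n) ∧
                (∀ v ∈ T n, ∃ (t w : HexVertex) (r : ℕ), v ∈ hexBall t r ∧ w ∈ hexBall t r ∧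
                  hexBall t r ⊆ T n ∧ Metric.infDist ((δ : ℂ) * hexCenter w) K ≤ ρ / 16))) ∧
          hexSAWLaw D.carrier δ (a δ) (b δ)
              {γ | ¬ ∃ (n m : ℕ) (p q : HexVertex) (n' m' : ℕ) (p' q' : HexVertex),
                  IsFirstGoodGateN D.carrier δ ρ R S (a δ) γ.walk.support n m p q ∧
                  IsFirstGoodGateN D.carrier δ ρ R T (b δ) γ.walk.support.reverse n' m' p' q' ∧
                  WideLink D.carrier δ ρ (S n ∪ T n') q q'} ≤
            ENNReal.ofReal ε :=
  Summit.CriticalPhenomena.SAWScalingLimit.Theorems.ObservableToSLE.TypeLadder.stub_bandIteration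

/-- S1ᶜ (r14's registered `stub_nestedRenewalConditional`, from r16 on GLUE over R1, I8): conditional abundance from band-wise renewal and
the no-backtracking hypothesis (`NoMacroBacktrackingAt` unfolds to it). -/
theorem stub_nestedRenewalConditional :
    HexObservableLimit → HexTight →
    Summit.CriticalPhenomena.SAWScalingLimit.Theses.SAWLatticeVirasoro.HexSimpleSubseqLimits →
    (∀ (D : DobrushinDomain) (a b : ℝ → HexVertex), IsEmbEndpointApprox hexGraph hexCenter D a b →
      ∀ R' > (0 : ℝ), ∀ ε > (0 : ℝ), ∃ r > (0 : ℝ), ∀ᶠ δ : ℝ in 𝓝[>] 0,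
        hexSAWLaw D.carrier δ (a δ) (b δ)
            {γ | ∃ (l₁ l₂ : List HexVertex) (u v : HexVertex), γ.walk.support = l₁ ++ u :: l₂ ∧ v ∈ l₂ ∧
              R' ≤ dist ((δ : ℂ) * hexCenter u) (D.pt 0) ∧ dist ((δ : ℂ) * hexCenter v) (D.pt 0) ≤ r} ≤
          ENNReal.ofReal ε ∧
        hexSAWLaw D.carrier δ (a δ) (b δ)
            {γ | ∃ (l₁ l₂ : List HexVertex) (u v : HexVertex), γ.walk.support = l₁ ++ u :: l₂ ∧ v ∈ l₂ ∧
              dist ((δ : ℂ) * hexCenter u) (D.pt 1) ≤ r ∧ R' ≤ dist ((δ : ℂ) * hexCenter v) (D.pt 1)} ≤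
          ENNReal.ofReal ε) →
    ∀ (D : DobrushinDomain) (a b : ℝ → HexVertex), IsEmbEndpointApprox hexGraph hexCenter D a b →
      ∀ ε > (0 : ℝ), ∃ R₂ > (0 : ℝ), ∀ R ∈ Set.Ioc (0 : ℝ) R₂, ∃ ρ > (0 : ℝ), ∃ N : ℕ, ∀ᶠ δ : ℝ in 𝓝[>] 0,
        ∃ S T : ℕ → Set HexVertex,
          TameNestedFamily δ R N (a δ) S ∧ TameNestedFamily δ R N (b δ) T ∧
          ((∀ n, ExteriorAnchored D.carrier δ (S n) (a δ)) ∧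
            (∀ n, ExteriorAnchored D.carrier δ (T n) (b δ)) ∧
            ∃ j : Fin 6,
              ((∀ (n : ℕ) (p q : HexVertex), HasCleanWindow D.carrier δ ρ (S n) p q →
                  rowOf j q = rowOf j p + 1 ∧
                    ∀ x : HexVertex, (δ : ℂ) * hexCenter x ∈ ball ((δ : ℂ) * hexCenter q) ρ →
                      (x ∈ S n ↔ rowOf j x ≤ rowOf j p)) ∧
                (∀ (n : ℕ) (p q : HexVertex), HasCleanWindow D.carrier δ ρ (T n) p q →
                  rowOf j q = rowOf j p + 1 ∧
                    ∀ x : HexVertex, (δ : ℂ) * hexCenter x ∈ ball ((δ : ℂ) * hexCenter q) ρ →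
                      (x ∈ T n ↔ rowOf j x ≤ rowOf j p))) ∧
              (∀ (n : ℕ) (p q : HexVertex), HasCleanWindow D.carrier δ ρ (S n) p q →
                ∃ K : Set ℂ, IsCompact K ∧ IsConnected K ∧
                  (δ : ℂ) * hexCenter q - ((ρ / 2 : ℝ) : ℂ) * Complex.I * triZeta ^ (j : ℕ) ∈ K ∧
                  (δ : ℂ) * hexCenter (a δ) ∈ K ∧
                  ∀ v : HexVertex, Metric.infDist ((δ : ℂ) * hexCenter v) K ≤ ρ / 4 → v ∈ S n) ∧
              (∀ (n : ℕ) (p q : HexVertex), HasCleanWindow D.carrier δ ρ (T n) p q →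
                ∃ K : Set ℂ, IsCompact K ∧ IsConnected K ∧
                  (δ : ℂ) * hexCenter q - ((ρ / 2 : ℝ) : ℂ) * Complex.I * triZeta ^ (j : ℕ) ∈ K ∧
                  (δ : ℂ) * hexCenter (b δ) ∈ K ∧
                  ∀ v : HexVertex, Metric.infDist ((δ : ℂ) * hexCenter v) K ≤ ρ / 4 → v ∈ T n) ∧
              (∀ n : ℕ, ∃ K : Set ℂ, IsCompact K ∧ IsConnected K ∧ (δ : ℂ) * hexCenter (a δ) ∈ K ∧
                (∀ v : HexVertex, Metric.infDist ((δ : ℂ) * hexCenter v) K ≤ ρ / 8 → v ∈ S n) ∧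
                (∀ v ∈ S n, ∃ (t w : HexVertex) (r : ℕ), v ∈ hexBall t r ∧ w ∈ hexBall t r ∧
                  hexBall t r ⊆ S n ∧ Metric.infDist ((δ : ℂ) * hexCenter w) K ≤ ρ / 16)) ∧
              (∀ n : ℕ, ∃ K : Set ℂ, IsCompact K ∧ IsConnected K ∧ (δ : ℂ) * hexCenter (b δ) ∈ K ∧
                (∀ v : HexVertex, Metric.infDist ((δ : ℂ) * hexCenter v) K ≤ ρ / 8 → v ∈ T n) ∧
                (∀ v ∈ T n, ∃ (t w : HexVertex) (r : ℕ), v ∈ hexBall t r ∧ w ∈ hexBall t r ∧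
                  hexBall t r ⊆ T n ∧ Metric.infDist ((δ : ℂ) * hexCenter w) K ≤ ρ / 16))) ∧
          hexSAWLaw D.carrier δ (a δ) (b δ)
              {γ | ¬ ∃ (n m : ℕ) (p q : HexVertex) (n' m' : ℕ) (p' q' : HexVertex),
                  IsFirstGoodGateN D.carrier δ ρ R S (a δ) γ.walk.support n m p q ∧
                  IsFirstGoodGateN D.carrier δ ρ R T (b δ) γ.walk.support.reverse n' m' p' q' ∧
                  WideLink D.carrier δ ρ (S n ∪ T n') q q'} ≤
            ENNReal.ofReal ε := fun hO hT h5 hNB =>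
  stub_bandIteration (stub_bandRenewal hO hT h5) (fun D a b hab => hNB D a b hab)

/-- STUB NB `stub_noMacroBacktracking` (NEW in r14; LANDED in r15, p168181 `TypeLadder.stub_noMacroBacktracking`, wired by name) — **no macroscopic backtracking from tightness and
simplicity of all subsequential limits**: `HexTight → HexSimpleSubseqLimits → NoMacroBacktracking`, all three inlined (the
`Modulus.stub_hexUniformModulus_of_simpleLimits` pattern: violating meshes `δ_j → 0⁺` chosen by `Filter.Frequently`, Prokhorov
`IsTightAlongMesh.exists_subseq` on the Dirac-padded push-forward laws, the closed decreasing events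
`F_r = mk '' {γ | ∃ s ≤ t, R′ ≤ dist (γ s) (pt 0) ∧ dist (γ t) (pt 0) ≤ r}` whose intersection over `r = 1/(m+1)` misses every
simple class with source `pt 0`, continuity from above, portmanteau `ProbabilityMeasure.limsup_measure_closed_le_of_tendsto`; the
lattice event maps into `F_r` by the vertex times of the polyline, `exists_vertexTimes_polylineFrom`). -/
theorem stub_noMacroBacktracking :
    (∀ (D : DobrushinDomain) (a b : ℝ → HexVertex), IsEmbEndpointApprox hexGraph hexCenter D a b →
      IsTightAlongMesh (fun δ (γ : HexDomainSAW D.carrier δ (a δ) (b δ)) => γ.curve)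
        (fun δ => hexSAWLaw D.carrier δ (a δ) (b δ))) →
    (∀ (D : DobrushinDomain) (a b : ℝ → HexVertex), IsEmbEndpointApprox hexGraph hexCenter D a b →
      ∀ (s : ℕ → ℝ) (ν : Measure (CurveClass ℂ)), Tendsto s atTop (𝓝[>] 0) → IsProbabilityMeasure ν →
        (∀ f : CurveClass ℂ →ᵇ ℝ,
          Tendsto (fun n => ∫ γ, f γ.curve ∂(hexSAWLaw D.carrier (s n) (a (s n)) (b (s n)))) atTop
            (𝓝 (∫ x, f x ∂ν))) →
        ∀ᵐ γ ∂ν, γ ∈ CurveClass.simple ∧ γ.source = D.pt 0 ∧ γ.target = D.pt 1 ∧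
          γ.range ⊆ closure D.carrier ∧ γ.range ∩ frontier D.carrier ⊆ {D.pt 0, D.pt 1}) →
    ∀ (D : DobrushinDomain) (a b : ℝ → HexVertex), IsEmbEndpointApprox hexGraph hexCenter D a b →
      ∀ R' > (0 : ℝ), ∀ ε > (0 : ℝ), ∃ r > (0 : ℝ), ∀ᶠ δ : ℝ in 𝓝[>] 0,
        hexSAWLaw D.carrier δ (a δ) (b δ)
            {γ | ∃ (l₁ l₂ : List HexVertex) (u v : HexVertex), γ.walk.support = l₁ ++ u :: l₂ ∧ v ∈ l₂ ∧
              R' ≤ dist ((δ : ℂ) * hexCenter u) (D.pt 0) ∧ dist ((δ : ℂ) * hexCenter v) (D.pt 0) ≤ r} ≤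
          ENNReal.ofReal ε ∧
        hexSAWLaw D.carrier δ (a δ) (b δ)
            {γ | ∃ (l₁ l₂ : List HexVertex) (u v : HexVertex), γ.walk.support = l₁ ++ u :: l₂ ∧ v ∈ l₂ ∧
              dist ((δ : ℂ) * hexCenter u) (D.pt 1) ≤ r ∧ R' ≤ dist ((δ : ℂ) * hexCenter v) (D.pt 1)} ≤
          ENNReal.ofReal ε :=
  Summit.CriticalPhenomena.SAWScalingLimit.Theorems.ObservableToSLE.TypeLadder.stub_noMacroBacktracking

/-- STUB T1⁻ `stub_macroSourceLocality` (r11; RESEARCH; = item **stmt-CriticalPhenomena-17955** verbatim) — **macroscopic source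
locality** at a flat-pinned root; consumed by the landed `Macro.stub_macroRestrictionLimit` (p145850). -/
theorem stub_macroSourceLocality :
    ∀ (E : DobrushinDomain) (ρ : ℝ) (Λ : ℝ → Finset HexVertex) (m₀ : ℝ → ℤ)
      (a : ℝ → Sym2 HexVertex),
      0 < ρ → E.carrier ∩ ball (E.pt 0) ρ = {z : ℂ | (E.pt 0).im < z.im} ∩ ball (E.pt 0) ρ →
      (∀ᶠ δ : ℝ in 𝓝[>] 0, hexDomainSimplyConnected (Λ δ) ∧
        (hexGraph.induce (↑(Λ δ) : Set HexVertex)).Preconnected ∧ a δ ∈ hexDomainBoundary (Λ δ) ∧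
        (∀ v ∈ Λ δ, (δ : ℂ) * hexCenter v ∈ E.carrier) ∧
        (∀ v : HexVertex, (δ : ℂ) * hexCenter v ∈ ball (E.pt 0) ρ → (v ∈ Λ δ ↔ m₀ δ ≤ v.1 1))) →
      (∀ K : Set ℂ, IsCompact K → K ⊆ E.carrier →
        ∀ᶠ δ : ℝ in 𝓝[>] 0, ∀ v : HexVertex, (δ : ℂ) * hexCenter v ∈ K → v ∈ Λ δ) →
      Tendsto (fun δ : ℝ => (δ : ℂ) * hexMidpoint (a δ)) (𝓝[>] 0) (𝓝 (E.pt 0)) →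
      ∀ ε : ℝ, 0 < ε → ∀ r : ℝ, 0 < r → ∃ t₀ : ℝ, 0 < t₀ ∧
        ∀ (s : ℝ → Sym2 HexVertex) (t : ℝ), t ≠ 0 → |t| < t₀ →
          (∀ᶠ δ : ℝ in 𝓝[>] 0, s δ ∈ hexDomainBoundary (Λ δ) ∧
            (hexMidpoint (s δ)).im = (hexMidpoint (a δ)).im) →
          Tendsto (fun δ : ℝ => (δ : ℂ) * hexMidpoint (s δ)) (𝓝[>] 0) (𝓝 (E.pt 0 + t)) →
          ∀ᶠ δ : ℝ in 𝓝[>] 0,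
            (∑ γ : HexMidEdgeSAW (Λ δ) (a δ) (s δ),
                if ∃ v ∈ γ.verts, r ≤ dist ((δ : ℂ) * hexCenter v) ((δ : ℂ) * hexMidpoint (a δ))
                then hexCriticalFugacity ^ γ.length else 0) ≤
              ε * ∑ γ : HexMidEdgeSAW (Λ δ) (a δ) (s δ), hexCriticalFugacity ^ γ.length := by
  sorry

/-- STUB T5ₐ `stub_hexSimpleSubseqLimits` (r7; RESEARCH; = item **stmt-CriticalPhenomena-7148** verbatim) — **simplicity of
subsequential limits**; consumed by `Modulus.stub_hexUniformModulus_of_simpleLimits` (p127640) inside the landed chain and, from r14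
on, by S1ᶜ and NB. -/
theorem stub_hexSimpleSubseqLimits :
    ∀ (D : DobrushinDomain) (a b : ℝ → HexVertex), IsEmbEndpointApprox hexGraph hexCenter D a b →
      ∀ (s : ℕ → ℝ) (ν : Measure (CurveClass ℂ)), Tendsto s atTop (𝓝[>] 0) → IsProbabilityMeasure ν →
        (∀ f : CurveClass ℂ →ᵇ ℝ,
          Tendsto (fun n => ∫ γ, f γ.curve ∂(hexSAWLaw D.carrier (s n) (a (s n)) (b (s n)))) atTop
            (𝓝 (∫ x, f x ∂ν))) →
        ∀ᵐ γ ∂ν, γ ∈ CurveClass.simple ∧ γ.source = D.pt 0 ∧ γ.target = D.pt 1 ∧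
          γ.range ⊆ closure D.carrier ∧ γ.range ∩ frontier D.carrier ⊆ {D.pt 0, D.pt 1} := by
  sorry

/-! ## Consistency: every registered stub is definitionally the typed statement it names -/

/-- S1ᶜ is `ConditionalAbundance`. -/
theorem conditionalAbundance_of_stub : ConditionalAbundance := stub_nestedRenewalConditional

/-- NB is `HexTight → HexSimpleSubseqLimits → NoMacroBacktracking`. -/
theorem noMacroBacktracking_of_stub (hT : HexTight) (h5 : HexSimpleSubseqLimits) : NoMacroBacktracking :=
  stub_noMacroBacktracking hT h5

/-- T1⁻ is `MacroSourceLocality`. -/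
theorem macroSourceLocality_of_stub : MacroSourceLocality := stub_macroSourceLocality

/-- T5ₐ is `HexSimpleSubseqLimits` (item 7148, the `SAWLatticeVirasoro` route decl). -/
theorem hexSimpleSubseqLimits_of_stub : HexSimpleSubseqLimits := stub_hexSimpleSubseqLimits

/-- The r1–r13 UNCONDITIONAL abundance `NestedRenewalFatCoSolidR` (item stmt-17698 as filed) trivially implies the r14
conditional stub: a landing of 17698 still closes the line. -/
theorem conditionalAbundance_of_unconditional (h : NestedRenewalFatCoSolidR) : ConditionalAbundance :=
  fun _ _ _ _ => h

/-- Conversely the twin line's 2-hypothesis form (`conditional-abundance` r2 on stmt-14005: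
`HexTight → HexSimpleSubseqLimits → S1`) implies this line's 4-hypothesis form. -/
theorem conditionalAbundance_of_twinForm (h : HexTight → HexSimpleSubseqLimits → NestedRenewalFatCoSolidR) :
    ConditionalAbundance :=
  fun _ hT h5 _ => h hT h5

/-- The abundance the composition consumes, from the r14 stubs: S1 under the crux hypotheses. -/
theorem nestedRenewalFatCoSolidR_of_stubs (hO : HexObservableLimit) (hT : HexTight) : NestedRenewalFatCoSolidR :=
  stub_nestedRenewalConditional hO hT stub_hexSimpleSubseqLimits
    (stub_noMacroBacktracking hT stub_hexSimpleSubseqLimits)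

/-! ## Composition (sorry-free): the skeleton concludes the crux BY NAME -/

/-- **`ObservableToSLE` from the four registered stubs (r14)**, through the LANDED residue theorem
`TypeLadder.observableToSLE_of_residue` (p163920: gate decomposition, nested transfer, co-oriented solid reduction, two-piece
identification, solid moving-carving squeeze, modulus from tightness + simple limits, identification criterion — all landed):
`R` and `HexTight` now also feed the conditional abundance. -/
theorem ObservableToSLE_of : ObservableToSLE := fun hO hT =>
  Summit.CriticalPhenomena.SAWScalingLimit.Theorems.ObservableToSLE.TypeLadder.observableToSLE_of_residue
    (nestedRenewalFatCoSolidR_of_stubs hO hT) stub_macroSourceLocality stub_hexSimpleSubseqLimits hO hT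

/-- The bet route's copy (payload `route-CriticalPhenomena-SAWSpinMonotone`): definitionally the same statement
(`spinMonotone_observableToSLE_iff_developingMap`, strategist b1, `Iff.rfl`). -/
theorem ObservableToSLE_of_spinMonotone :
    Summit.CriticalPhenomena.SAWScalingLimit.Theses.SAWSpinMonotone.ObservableToSLE :=
  ObservableToSLE_of

end Summit.CriticalPhenomena.SAWScalingLimit.Cruxes.ObservableToSLE.TypeLadder

end
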